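import Summits.Schanuel.Schanuel.Theorems.RootDecomp1KHyper29

/-!
# RootDecomp1KHyper — lens 6, generation 15 ADDENDUM «EXP-LATTICE-ANCHORED CELL» (ExpAnchorT.lean v2 88910796…, 2341 l) — continuation (RootDecomp1KHyper30): §3 EXTRACTION `hyperLatApprox_of_anchor`; §4 the cells: `sb_three_of_latAnchor`, `HasExpIntAnchor` / `HasExpPairAnchor` / `HasExpLatAnchor` (+ `.mono`, `_congr_span`), MAIN `sb_three_of_expIntAnchor` / `_expPairAnchor` / `_expLatAnchor` (mod hLW), carves `rank3SpanResidual_iff_of_cell(s)` / `rank3SpanResidual_iff_expUnanchored`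

(lens-6 g15-addendum `ExpAnchorT.lean` v2, sha256 88910796…cc8b, farm rc 0 · 0 sorry · axioms std; port by census-1 gen 14 in eight parts RootDecomp1KHyper28–35, cuts of CENSUS-REQUEST STATUS L1561 re-balanced for the 400-line cap,
critic PORT GO L1568 (e) / ACK L1571; import `RootDecomp1KHyper26`, the source's verbatim g15 plane-lemma copy dropped (exported by Hyper26 in `…HyperCell`), sub-namespace `…HyperCell.LatCell` kept; statements and proofs verbatim
(55 docstrings added, seven generic one-liners privatised with per-part private copies); `hLW : LWMeasure` (tree-proved named fact) stays a binder; `--supports stmt-Schanuel-33363` (residual of record n = 3 := UnanchoredResidual₃′). Nothing here proves Schanuel; rung 0.)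
-/

noncomputable section

open Complex IntermediateField Polynomial

namespace Summit.Schanuel.Schanuel.Theorems.RootDecomp1KHyper

namespace HyperCell

namespace LatCell

variable {n : ℕ}
open Summit.Schanuel.Schanuel.Theorems.RootDecomp1KGeneric (HasHLPairInSpan Rank3SpanResidual
  mem_adjoin_of_mem_span cexp_mem_adjoin_of_mem_span)

/-- **EXTRACTION (lattice version)**: the coordinate `y = z_j` (`c_j ≠ 0`) of a ℚ-free
`HyperLinLiouville` triple whose ℤ-span contains `w₁, w₂` with `LatLB w₁ w₂` is hyper-approximable
from the lattice `ℤ w₁ + ℤ w₂` — the approximants are read off the small forms: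
`|C| z_j − (A' w₁ + B' w₂) = ± c_j (h·z)`, height `≪ |h|₁`. -/
theorem hyperLatApprox_of_anchor {z : Fin 3 → ℂ} (hz : LinearIndependent ℚ z)
    (hH : HyperLinLiouville z) {w₁ w₂ : ℂ} (hLB : LatLB w₁ w₂) {a b : Fin 3 → ℤ}
    (ha : ∑ i, (a i : ℂ) * z i = w₁) (hb : ∑ i, (b i : ℂ) * z i = w₂) {j : Fin 3}
    (hj : cvec a b j ≠ 0) : HyperLatApprox w₁ w₂ (z j) := by
  intro m
  set Sa : ℝ := ∑ i, |(a i : ℝ)| with hSa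
  set Sb : ℝ := ∑ i, |(b i : ℝ)| with hSb
  set Sc : ℝ := ∑ i, |(cvec a b i : ℝ)| with hSc
  have hSa0 : 0 ≤ Sa := Finset.sum_nonneg fun _ _ => abs_nonneg _
  have hSb0 : 0 ≤ Sb := Finset.sum_nonneg fun _ _ => abs_nonneg _
  have hSc0 : 0 ≤ Sc := Finset.sum_nonneg fun _ _ => abs_nonneg _
  set cj : ℝ := |(cvec a b j : ℝ)| with hcj
  have hcj1 : 1 ≤ cj := by rw [hcj, ← Int.cast_abs]; exact_mod_cast Int.one_le_abs hj
  have hcj0 : 0 < cj := by linarith only [hcj1]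
  set κ₂ : ℝ := 1 + Sc + Sb + Sa with hκ₂
  have hκ₂1 : 1 ≤ κ₂ := by rw [hκ₂]; linarith only [hSa0, hSb0, hSc0]
  obtain ⟨mL, hmL⟩ := exists_level_dot_ne_zeroL hz hLB ha hb hj
  obtain ⟨T₀, hT₀⟩ := exists_le_two_pow (κ₂ + cj)
  obtain ⟨T, hT⟩ : ∃ T : ℕ, T = T₀ + mL + 1 := ⟨_, rfl⟩
  -- the small form at level m T + T
  obtain ⟨h, hh, hsmall⟩ := hH (m * T + T)
  have hC := hmL (m * T + T) (le_trans (by omega) (Nat.le_add_left T (m * T))) h hh hsmall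
  set C : ℤ := ∑ i, cvec a b i * h i with hCdef
  set Sh : ℝ := ∑ i, |(h i : ℝ)| with hSh
  set W : ℝ := 1 + Sh with hW
  have hSh1 : 1 ≤ Sh := one_le_hsum hh
  have hW2 : 2 ≤ W := by rw [hW]; linarith only [hSh1]
  have hW1 : 1 ≤ W := by linarith only [hW2]
  have hW0 : 0 < W := by linarith only [hW2]
  have hShW : Sh ≤ W := by rw [hW]; linarith only [hSh1]
  set F : ℂ := ∑ i, (h i : ℂ) * z i with hF
  have hF0 : F ≠ 0 := form_ne_zero_of_linearIndependent hz hh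
  have hkey := cvec_key a b h z j
  rw [← hF, ← hCdef, ha, hb] at hkey
  set A : ℤ := cvec h b j with hA
  set B : ℤ := cvec a h j with hB
  have hCabs : 1 ≤ |(C : ℝ)| := by rw [← Int.cast_abs]; exact_mod_cast Int.one_le_abs hC
  -- the sign of C and the approximant (A' w₁ + B' w₂)/Q, Q = |C|
  set σ : ℤ := C.sign with hσ
  have hσ1 : σ = 1 ∨ σ = -1 := by
    rcases lt_or_gt_of_ne hC with hlt | hgt
    · exact Or.inr (Int.sign_eq_neg_one_of_neg hlt)
    · exact Or.inl (Int.sign_eq_one_of_pos hgt)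
  set Q : ℕ := C.natAbs with hQ
  set A' : ℤ := -(σ * A) with hA'
  set B' : ℤ := -(σ * B) with hB'
  have hQpos : 0 < Q := Int.natAbs_pos.mpr hC
  have hQposR : (0 : ℝ) < Q := by exact_mod_cast hQpos
  have hQ1 : (1 : ℝ) ≤ Q := by exact_mod_cast hQpos
  have hQC : (Q : ℂ) ≠ 0 := by exact_mod_cast hQpos.ne'
  have hQR : (Q : ℝ) = |(C : ℝ)| := by rw [hQ, Nat.cast_natAbs, Int.cast_abs]
  have hQZ : ((Q : ℕ) : ℤ) = σ * C := by rw [hQ, hσ]; exact (Int.sign_mul_self_eq_natAbs C).symm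
  have hQCx : (Q : ℂ) = (σ : ℂ) * (C : ℂ) := by exact_mod_cast hQZ
  have hσabsR : |(σ : ℝ)| = 1 := by rcases hσ1 with h1 | h1 <;> simp [h1]
  have hσnorm : ‖(σ : ℂ)‖ = 1 := by rcases hσ1 with h1 | h1 <;> simp [h1]
  have hσ0 : (σ : ℂ) ≠ 0 := by
    intro h0; rw [h0, norm_zero] at hσnorm; exact zero_ne_one hσnorm
  have hcjC : (cvec a b j : ℂ) ≠ 0 := by exact_mod_cast hj
  -- Q z_j − (A' w₁ + B' w₂) = σ c_j F
  have hQy : (Q : ℂ) * z j - (((A' : ℤ) : ℂ) * w₁ + ((B' : ℤ) : ℂ) * w₂) =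
      (σ : ℂ) * ((cvec a b j : ℂ) * F) := by
    rw [hkey, hQCx, hA', hB']; push_cast; ring
  have hdiff : z j - (((A' : ℤ) : ℂ) * w₁ + ((B' : ℤ) : ℂ) * w₂) / (Q : ℂ) =
      (σ : ℂ) * ((cvec a b j : ℂ) * F) / (Q : ℂ) := by
    rw [← hQy]; field_simp
  have hdist : ‖z j - (((A' : ℤ) : ℂ) * w₁ + ((B' : ℤ) : ℂ) * w₂) / (Q : ℂ)‖ <
      cj * Real.exp (-(W ^ (m * T + T))) := by
    rw [hdiff, norm_div, norm_mul, norm_mul, hσnorm, one_mul, Complex.norm_natCast,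
      Complex.norm_intCast, ← hcj]
    calc cj * ‖F‖ / (Q : ℝ) ≤ cj * ‖F‖ := div_le_self (by positivity) hQ1
      _ < cj * Real.exp (-(W ^ (m * T + T))) := mul_lt_mul_of_pos_left hsmall hcj0
  have hyne : z j ≠ (((A' : ℤ) : ℂ) * w₁ + ((B' : ℤ) : ℂ) * w₂) / (Q : ℂ) := by
    intro h0
    have h1 : (σ : ℂ) * ((cvec a b j : ℂ) * F) / (Q : ℂ) = 0 := by rw [← hdiff, ← h0, sub_self]
    rw [div_eq_zero_iff] at h1
    rcases h1 with h1 | h1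
    · rcases mul_eq_zero.mp h1 with h2 | h2
      · exact hσ0 h2
      · rcases mul_eq_zero.mp h2 with h3 | h3
        · exact hcjC h3
        · exact hF0 h3
    · exact hQC h1
  -- height of the approximant: 1 + Q + |A'| + |B'| ≤ κ₂ W
  have hAle : |(A : ℝ)| ≤ Sh * Sb := abs_cvec_le h b j
  have hBle : |(B : ℝ)| ≤ Sa * Sh := abs_cvec_le a h j
  have hCle : |(C : ℝ)| ≤ Sc * Sh := by rw [hCdef]; exact abs_dot_le (cvec a b) h
  have hsize : 1 + (Q : ℝ) + |(A' : ℝ)| + |(B' : ℝ)| ≤ κ₂ * W := by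
    rw [hQR, hA', hB']
    push_cast
    simp only [abs_neg, abs_mul, hσabsR, one_mul]
    have h1 : |(C : ℝ)| ≤ W * Sc := hCle.trans (by nlinarith only [hShW, hSc0])
    have h2 : |(A : ℝ)| ≤ W * Sb := hAle.trans (mul_le_mul_of_nonneg_right hShW hSb0)
    have h3 : |(B : ℝ)| ≤ Sa * W := hBle.trans (mul_le_mul_of_nonneg_left hShW hSa0)
    rw [hκ₂]; nlinarith only [h1, h2, h3, hW1, hSa0, hSb0, hSc0]
  -- level bookkeeping: cj · exp(−W^(mT+T)) ≤ exp(−(κ₂ W)^m)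
  have hT₀1 : (1 : ℝ) ≤ 2 ^ T₀ := one_le_pow₀ (by norm_num)
  have h2T : κ₂ ≤ (2 : ℝ) ^ (T₀ + mL) := by
    calc κ₂ ≤ 2 ^ T₀ := by linarith only [hT₀, hcj0]
      _ ≤ 2 ^ (T₀ + mL) := pow_le_pow_right₀ (by norm_num) (by omega)
  have hWT : κ₂ * W ≤ W ^ T := by
    rw [hT, pow_succ]
    apply mul_le_mul_of_nonneg_right _ hW0.le
    exact h2T.trans (pow_le_pow_left₀ (by norm_num) hW2 _)
  have hWT' : cj + 1 ≤ W ^ T := by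
    calc cj + 1 ≤ 2 ^ T₀ + 2 ^ T₀ := by linarith only [hT₀, hT₀1, hκ₂1]
      _ = 2 ^ (T₀ + 1) := by rw [pow_succ]; ring
      _ ≤ 2 ^ T := pow_le_pow_right₀ (by norm_num) (by omega)
      _ ≤ W ^ T := pow_le_pow_left₀ (by norm_num) hW2 _
  have hκW1 : 1 ≤ κ₂ * W := one_le_mul_of_one_le_of_one_le hκ₂1 hW1
  have hκW0 : 0 ≤ κ₂ * W := by linarith only [hκW1]
  have hWT0 : 0 ≤ W ^ T := pow_nonneg hW0.le T
  have hmain : (κ₂ * W) ^ m + cj ≤ W ^ (m * T + T) := by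
    have e : W ^ (m * T + T) = (W ^ T) ^ m * W ^ T := by
      rw [pow_add, mul_comm m T, pow_mul]
    rw [e]
    have h1 : (κ₂ * W) ^ m ≤ (W ^ T) ^ m := pow_le_pow_left₀ hκW0 hWT m
    have h2 : 1 ≤ (κ₂ * W) ^ m := one_le_pow₀ hκW1
    have h3 : (κ₂ * W) ^ m * (cj + 1) ≤ (W ^ T) ^ m * W ^ T :=
      mul_le_mul h1 hWT' (by linarith only [hcj0]) (pow_nonneg hWT0 m)
    have h4 : cj ≤ (κ₂ * W) ^ m * cj := le_mul_of_one_le_left hcj0.le h2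
    calc (κ₂ * W) ^ m + cj ≤ (κ₂ * W) ^ m + (κ₂ * W) ^ m * cj := by linarith only [h4]
      _ = (κ₂ * W) ^ m * (cj + 1) := by ring
      _ ≤ (W ^ T) ^ m * W ^ T := h3
  have hfinal : cj * Real.exp (-(W ^ (m * T + T))) ≤
      Real.exp (-((1 + (Q : ℝ) + |(A' : ℝ)| + |(B' : ℝ)|) ^ m)) := by
    have hlog : Real.log cj ≤ cj - 1 := Real.log_le_sub_one_of_pos hcj0
    have h1 : cj * Real.exp (-(W ^ (m * T + T))) =
        Real.exp (Real.log cj + -(W ^ (m * T + T))) := by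
      rw [Real.exp_add, Real.exp_log hcj0]
    rw [h1]
    apply Real.exp_le_exp.mpr
    have h0 : 0 ≤ 1 + (Q : ℝ) + |(A' : ℝ)| + |(B' : ℝ)| := by
      linarith only [hQposR, abs_nonneg (A' : ℝ), abs_nonneg (B' : ℝ)]
    have h2 : (1 + (Q : ℝ) + |(A' : ℝ)| + |(B' : ℝ)|) ^ m ≤ (κ₂ * W) ^ m :=
      pow_le_pow_left₀ h0 hsize m
    linarith only [hlog, h2, hmain]
  exact ⟨A', B', Q, hQpos, hyne, hdist.trans_le hfinal⟩

/-! ## §4  The lattice-anchored cells of the level-3 span residual, decided (mod the LW measure) -/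

open Summit.Schanuel.Schanuel.Theorems.RootDecomp1KGeneric (HasHLPairInSpan Rank3SpanResidual
  mem_adjoin_of_mem_span cexp_mem_adjoin_of_mem_span)

/-- **ABSTRACT CELL (kernel).**  A ℚ-free `HyperLinLiouville` triple whose Schanuel field contains a
PAIR `θ` with an `MvPolyMeasure` and whose ℤ-span contains the values `W₁(θ), W₂(θ)` of two
ℤ-linearly independent integer polynomials has Schanuel's bound `trdeg ℚ(z, e^z) ≥ 3`. -/
theorem sb_three_of_latAnchor {z : Fin 3 → ℂ} (hz : LinearIndependent ℚ z)
    (hH : HyperLinLiouville z) {θ : Fin 2 → ℂ} (hθ : MvPolyMeasure θ)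
    (hθz : ∀ i, θ i ∈ adjoin ℚ (SFset z ∪ {I})) (W₁ W₂ : MvPolynomial (Fin 2) ℤ)
    (hW : ∀ U V : ℤ, (U ≠ 0 ∨ V ≠ 0) → MvPolynomial.C U * W₁ + MvPolynomial.C V * W₂ ≠ 0)
    {w₁ w₂ : ℂ} (hw₁ : MvPolynomial.aeval θ W₁ = w₁) (hw₂ : MvPolynomial.aeval θ W₂ = w₂)
    (h₁ : w₁ ∈ Submodule.span ℤ (Set.range z)) (h₂ : w₂ ∈ Submodule.span ℤ (Set.range z)) :
    SB 3 z := by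
  obtain ⟨a, ha⟩ := (Submodule.mem_span_range_iff_exists_fun ℤ).mp h₁
  obtain ⟨b, hb⟩ := (Submodule.mem_span_range_iff_exists_fun ℤ).mp h₂
  simp only [zsmul_eq_mul] at ha hb
  have hLB := latLB_of_mvPolyMeasure hθ W₁ W₂ hW
  rw [hw₁, hw₂] at hLB
  obtain ⟨j, hj⟩ := exists_cvec_ne_zeroL hLB ha hb
  have hy := hyperLatApprox_of_anchor hz hH hLB ha hb hj
  rw [← hw₁, ← hw₂] at hy
  exact sb_of_hyperLat_of_mvWeakMeasure (n := 2) (MvPolyMeasure.mvWeakMeasure hθ) hθz W₁ W₂ hy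
    (mem_adjoin_SFset_I' (Or.inl ⟨j, rfl⟩))

/-- **`HasExpIntAnchor z`** (X-cell, one exponential) — the ℤ-span of the tuple contains a non-zero
INTEGER `N₁` and a non-zero integer multiple `N₂ e^{α}` of the exponential of an IRRATIONAL ALGEBRAIC
`α`.  A property of the lattice `span_ℤ(z)` only (re-basing-invariant, padding-monotone). -/
def HasExpIntAnchor {N : ℕ} (z : Fin N → ℂ) : Prop :=
  ∃ (α : ℂ) (N₁ N₂ : ℤ), IsAlgebraic ℚ α ∧ (∀ r : ℚ, α ≠ (r : ℂ)) ∧ N₁ ≠ 0 ∧ N₂ ≠ 0 ∧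
    (N₁ : ℂ) ∈ Submodule.span ℤ (Set.range z) ∧
    (N₂ : ℂ) * cexp α ∈ Submodule.span ℤ (Set.range z)

/-- **`HasExpPairAnchor z`** (X-cell, two exponentials) — the ℤ-span of the tuple contains non-zero
integer multiples `N₁ e^{α₁}, N₂ e^{α₂}` of the exponentials of two ℚ-linearly independent
ALGEBRAIC numbers `α₁, α₂`.  A property of the lattice `span_ℤ(z)` only. -/
def HasExpPairAnchor {N : ℕ} (z : Fin N → ℂ) : Prop :=
  ∃ (α : Fin 2 → ℂ) (N₁ N₂ : ℤ), (∀ i, IsAlgebraic ℚ (α i)) ∧ LinearIndependent ℚ α ∧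
    N₁ ≠ 0 ∧ N₂ ≠ 0 ∧
    (N₁ : ℂ) * cexp (α 0) ∈ Submodule.span ℤ (Set.range z) ∧
    (N₂ : ℂ) * cexp (α 1) ∈ Submodule.span ℤ (Set.range z)

/-- **`HasExpLatAnchor z`** — either X-cell anchor. -/
def HasExpLatAnchor {N : ℕ} (z : Fin N → ℂ) : Prop := HasExpIntAnchor z ∨ HasExpPairAnchor z

/-- `HasExpIntAnchor` is monotone along inclusions of `ℤ`-spans (re-basing invariant, padding-monotone). -/
theorem HasExpIntAnchor.mono {N N' : ℕ} {z : Fin N → ℂ} {z' : Fin N' → ℂ}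
    (hle : Submodule.span ℤ (Set.range z) ≤ Submodule.span ℤ (Set.range z'))
    (h : HasExpIntAnchor z) : HasExpIntAnchor z' := by
  obtain ⟨α, N₁, N₂, hα, hirr, h1, h2, hm1, hm2⟩ := h
  exact ⟨α, N₁, N₂, hα, hirr, h1, h2, hle hm1, hle hm2⟩

/-- `HasExpPairAnchor` is monotone along inclusions of `ℤ`-spans. -/
theorem HasExpPairAnchor.mono {N N' : ℕ} {z : Fin N → ℂ} {z' : Fin N' → ℂ}
    (hle : Submodule.span ℤ (Set.range z) ≤ Submodule.span ℤ (Set.range z'))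
    (h : HasExpPairAnchor z) : HasExpPairAnchor z' := by
  obtain ⟨α, N₁, N₂, hα, hli, h1, h2, hm1, hm2⟩ := h
  exact ⟨α, N₁, N₂, hα, hli, h1, h2, hle hm1, hle hm2⟩

/-- `HasExpLatAnchor` is monotone along inclusions of `ℤ`-spans. -/
theorem HasExpLatAnchor.mono {N N' : ℕ} {z : Fin N → ℂ} {z' : Fin N' → ℂ}
    (hle : Submodule.span ℤ (Set.range z) ≤ Submodule.span ℤ (Set.range z'))
    (h : HasExpLatAnchor z) : HasExpLatAnchor z' :=
  h.elim (fun h1 => Or.inl (h1.mono hle)) (fun h2 => Or.inr (h2.mono hle))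

/-- `GL_N(ℤ)`-re-basing invariance (indeed: dependence on the lattice `span_ℤ(z)` only). -/
theorem hasExpLatAnchor_congr_span {N N' : ℕ} {z : Fin N → ℂ} {z' : Fin N' → ℂ}
    (heq : Submodule.span ℤ (Set.range z) = Submodule.span ℤ (Set.range z')) :
    HasExpLatAnchor z ↔ HasExpLatAnchor z' :=
  ⟨HasExpLatAnchor.mono heq.le, HasExpLatAnchor.mono heq.ge⟩

/-- `(N, α)` is ℚ-linearly independent for `N ∈ ℤ ∖ {0}` and `α ∉ ℚ`. -/
theorem linearIndependent_int_irrat {α : ℂ} (hirr : ∀ r : ℚ, α ≠ (r : ℂ)) {N₁ : ℤ} (hN₁ : N₁ ≠ 0) :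
    LinearIndependent ℚ (![(N₁ : ℂ), α] : Fin 2 → ℂ) := by
  rw [LinearIndependent.pair_iff]
  intro s t hst
  have hN₁C : (N₁ : ℂ) ≠ 0 := by exact_mod_cast hN₁
  by_cases ht : t = 0
  · rw [ht, zero_smul, add_zero, smul_eq_zero] at hst
    exact ⟨hst.resolve_right hN₁C, ht⟩
  · exfalso
    apply hirr (-(s * N₁) / t)
    have htC : ((t : ℚ) : ℂ) ≠ 0 := by exact_mod_cast ht
    have hst' : (s : ℂ) * (N₁ : ℂ) + (t : ℂ) * α = 0 := by
      simpa [Rat.smul_def, smul_eq_mul] using hst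
    push_cast
    rw [eq_div_iff htC]
    linear_combination hst'

/-- The X-cell polynomials `N₁` and `N₂ X₁` are ℤ-linearly independent. -/
theorem indep_C_CX {N₁ N₂ : ℤ} (hN₁ : N₁ ≠ 0) (hN₂ : N₂ ≠ 0) (U V : ℤ) (hUV : U ≠ 0 ∨ V ≠ 0) :
    MvPolynomial.C U * MvPolynomial.C N₁ +
      MvPolynomial.C V * (MvPolynomial.C N₂ * MvPolynomial.X (1 : Fin 2)) ≠
        (0 : MvPolynomial (Fin 2) ℤ) := by
  intro h0
  have h1 := congr_arg (MvPolynomial.eval (fun _ => (0 : ℤ))) h0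
  have h2 := congr_arg (MvPolynomial.eval (fun _ => (1 : ℤ))) h0
  simp only [map_add, map_mul, MvPolynomial.eval_C, MvPolynomial.eval_X, map_zero, mul_zero,
    mul_one, add_zero] at h1 h2
  have hU : U = 0 := (mul_eq_zero.mp h1).resolve_right hN₁
  rw [hU, zero_mul, zero_add] at h2
  have hV : V = 0 := (mul_eq_zero.mp h2).resolve_right hN₂
  rcases hUV with h | h
  · exact h hU
  · exact h hV

/-- The X-cell polynomials `N₁ X₀` and `N₂ X₁` are ℤ-linearly independent. -/
theorem indep_CX_CX {N₁ N₂ : ℤ} (hN₁ : N₁ ≠ 0) (hN₂ : N₂ ≠ 0) (U V : ℤ) (hUV : U ≠ 0 ∨ V ≠ 0) :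
    MvPolynomial.C U * (MvPolynomial.C N₁ * MvPolynomial.X (0 : Fin 2)) +
      MvPolynomial.C V * (MvPolynomial.C N₂ * MvPolynomial.X (1 : Fin 2)) ≠
        (0 : MvPolynomial (Fin 2) ℤ) := by
  intro h0
  have h1 := congr_arg (MvPolynomial.eval (fun i : Fin 2 => if i = 0 then (1 : ℤ) else 0)) h0
  have h2 := congr_arg (MvPolynomial.eval (fun i : Fin 2 => if i = 1 then (1 : ℤ) else 0)) h0
  simp only [map_add, map_mul, MvPolynomial.eval_C, MvPolynomial.eval_X, map_zero] at h1 h2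
  simp only [Fin.isValue, ↓reduceIte, mul_one, one_ne_zero, mul_zero, add_zero,
    zero_ne_one, zero_add] at h1 h2
  have hU : U = 0 := (mul_eq_zero.mp h1).resolve_right hN₁
  have hV : V = 0 := (mul_eq_zero.mp h2).resolve_right hN₂
  rcases hUV with h | h
  · exact h hU
  · exact h hV

/-- A non-zero integer multiple of `x` in the Schanuel field puts `x` in the Schanuel field. -/
theorem mem_adjoin_of_int_mul_mem {N : ℕ} {z : Fin N → ℂ} {x : ℂ} {N₂ : ℤ} (hN₂ : N₂ ≠ 0)
    (h : (N₂ : ℂ) * x ∈ adjoin ℚ (SFset z ∪ {I})) : x ∈ adjoin ℚ (SFset z ∪ {I}) := by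
  have hN₂C : (N₂ : ℂ) ≠ 0 := by exact_mod_cast hN₂
  have e : x = (N₂ : ℂ) * x / (N₂ : ℂ) := by field_simp
  rw [e]
  exact div_mem h (intCast_mem _ N₂)

/-- **MAIN THEOREM, X-cell with one exponential (mod the LW measure).**  A ℚ-free
`HyperLinLiouville` triple whose ℤ-span contains a non-zero integer and a non-zero integer multiple
of `e^{α}`, `α ∈ ℚ̄ ∖ ℚ`, has Schanuel's bound `trdeg ℚ(z, e^z) ≥ 3`.  (Measured pair
`θ = (e^{N₁}, e^{α})`, lattice polynomials `W₁ = N₁`, `W₂ = N₂ X₁`.) -/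
theorem sb_three_of_expIntAnchor (hLW : LWMeasure) {z : Fin 3 → ℂ} (hz : LinearIndependent ℚ z)
    (hH : HyperLinLiouville z) (hA : HasExpIntAnchor z) : SB 3 z := by
  obtain ⟨α, N₁, N₂, hα, hirr, hN₁, hN₂, hm₁, hm₂⟩ := hA
  set u : Fin 2 → ℂ := ![(N₁ : ℂ), α] with hu
  have hua : ∀ i, IsAlgebraic ℚ (u i) := by
    intro i
    match i with
    | 0 => simpa [hu] using isAlgebraic_algebraMap (R := ℚ) (A := ℂ) (N₁ : ℚ)
    | 1 => simpa [hu] using hα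
  have hli : LinearIndependent ℚ u := linearIndependent_int_irrat hirr hN₁
  have hθ := mvPolyMeasure_exp_of_LW hLW hua hli
  refine sb_three_of_latAnchor hz hH hθ ?_ (MvPolynomial.C N₁)
    (MvPolynomial.C N₂ * MvPolynomial.X 1) (indep_C_CX hN₁ hN₂) ?_ ?_ hm₁ hm₂
  · intro i
    match i with
    | 0 => simpa [hu] using cexp_mem_adjoin_of_mem_span hm₁
    | 1 => simpa [hu] using mem_adjoin_of_int_mul_mem hN₂ (mem_adjoin_of_mem_span hm₂)
  · simp
  · simp [hu]

/-- **MAIN THEOREM, X-cell with two exponentials (mod the LW measure).**  A ℚ-free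
`HyperLinLiouville` triple whose ℤ-span contains non-zero integer multiples of `e^{α₁}, e^{α₂}`,
`α₁, α₂ ∈ ℚ̄` ℚ-linearly independent, has Schanuel's bound `trdeg ℚ(z, e^z) ≥ 3`.  (Measured pair
`θ = (e^{α₁}, e^{α₂})`, lattice polynomials `W₁ = N₁ X₀`, `W₂ = N₂ X₁`.) -/
theorem sb_three_of_expPairAnchor (hLW : LWMeasure) {z : Fin 3 → ℂ} (hz : LinearIndependent ℚ z)
    (hH : HyperLinLiouville z) (hA : HasExpPairAnchor z) : SB 3 z := by
  obtain ⟨α, N₁, N₂, hα, hli, hN₁, hN₂, hm₁, hm₂⟩ := hA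
  have hθ := mvPolyMeasure_exp_of_LW hLW hα hli
  refine sb_three_of_latAnchor hz hH hθ ?_ (MvPolynomial.C N₁ * MvPolynomial.X 0)
    (MvPolynomial.C N₂ * MvPolynomial.X 1) (indep_CX_CX hN₁ hN₂) ?_ ?_ hm₁ hm₂
  · intro i
    match i with
    | 0 => exact mem_adjoin_of_int_mul_mem hN₁ (mem_adjoin_of_mem_span hm₁)
    | 1 => exact mem_adjoin_of_int_mul_mem hN₂ (mem_adjoin_of_mem_span hm₂)
  · simp
  · simp

/-- **MAIN THEOREM (the exponential-lattice-anchored cell, mod the LW measure).** -/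
theorem sb_three_of_expLatAnchor (hLW : LWMeasure) {z : Fin 3 → ℂ} (hz : LinearIndependent ℚ z)
    (hH : HyperLinLiouville z) (hA : HasExpLatAnchor z) : SB 3 z :=
  hA.elim (sb_three_of_expIntAnchor hLW hz hH) (sb_three_of_expPairAnchor hLW hz hH)

/-- **The residual SPLIT along any decided cell (pure logic).** -/
theorem rank3SpanResidual_iff_of_cell {Q : (Fin 3 → ℂ) → Prop}
    (hQ : ∀ z : Fin 3 → ℂ, LinearIndependent ℚ z → HyperLinLiouville z → Q z → SB 3 z) :
    Rank3SpanResidual ↔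
      ∀ z : Fin 3 → ℂ, LinearIndependent ℚ z → HyperLinLiouville z →
        ¬ HasHLPairInSpan z → ¬ Q z → SB 3 z :=
  ⟨fun hR z hz hH hp _ => hR z hz hH hp, fun hR z hz hH hp => by
    by_cases hq : Q z
    · exact hQ z hz hH hq
    · exact hR z hz hH hp hq⟩

/-- **The residual SPLIT along two decided cells (pure logic)** — with `Q₁ = HasRealQuadAnchor`
(gen 15, `QuadAnchor`) and `Q₂ = HasExpLatAnchor` (this file) the right-hand side is the joint
un-anchored residual `UnanchoredResidual₃ ∧ ¬HasExpLatAnchor`. -/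
theorem rank3SpanResidual_iff_of_cells {Q₁ Q₂ : (Fin 3 → ℂ) → Prop}
    (hQ₁ : ∀ z : Fin 3 → ℂ, LinearIndependent ℚ z → HyperLinLiouville z → Q₁ z → SB 3 z)
    (hQ₂ : ∀ z : Fin 3 → ℂ, LinearIndependent ℚ z → HyperLinLiouville z → Q₂ z → SB 3 z) :
    Rank3SpanResidual ↔
      ∀ z : Fin 3 → ℂ, LinearIndependent ℚ z → HyperLinLiouville z →
        ¬ HasHLPairInSpan z → ¬ Q₁ z → ¬ Q₂ z → SB 3 z :=
  ⟨fun hR z hz hH hp _ _ => hR z hz hH hp, fun hR z hz hH hp => by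
    by_cases h1 : Q₁ z
    · exact hQ₁ z hz hH h1
    · by_cases h2 : Q₂ z
      · exact hQ₂ z hz hH h2
      · exact hR z hz hH hp h1 h2⟩

/-- **The residual SPLIT along the exponential-lattice-anchored cell (mod the LW measure).**  The span
residual is EQUIVALENT to its exp-un-anchored part: the X-cells are decided. -/
theorem rank3SpanResidual_iff_expUnanchored (hLW : LWMeasure) :
    Rank3SpanResidual ↔
      ∀ z : Fin 3 → ℂ, LinearIndependent ℚ z → HyperLinLiouville z →
        ¬ HasHLPairInSpan z → ¬ HasExpLatAnchor z → SB 3 z :=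
  rank3SpanResidual_iff_of_cell fun _ hz hH hA => sb_three_of_expLatAnchor hLW hz hH hA

end LatCell

end HyperCell

end Summit.Schanuel.Schanuel.Theorems.RootDecomp1KHyper
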